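import Literature.Analysis.FluidPDE.PoissonVeryWeakInterior
import HarnessLib

/-!
# Iterated directional integration by parts, and norms of multilinear maps through a basis

Analysis/FluidPDE support file (theorems only; no definitions, no named facts), part of the
proof of the named fact `Literature.Analysis.FluidPDE.jia_sverak_2014_local_higher_regularity`
(`JiaSverak2014LocalRegularity.lean`; H. Jia, V. Šverák, Invent. Math. 196 (2014) =
arXiv:1204.0529, §4: bounds on `∂ₜ∂ₓ^α u` from the equation). To read off time-Lipschitz bounds
of the spatial derivatives `Dᵐu(t)` from the weak form of the equations one tests with iterated
directional derivatives `Dᵐφ(x)[W]` of bump functions and integrates by parts `m` times; the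
order of the directions is reversed in the process, which is immaterial for bounds.

* `integral_mul_iteratedFDeriv_apply_eq` — `∫ g · Dᵐφ[W] = (-1)ᵐ ∫ Dᵐg[W ∘ rev] · φ` for
  `g ∈ Cᵐ` and a smooth compactly supported `φ`;
* `norm_le_sum_norm_apply_basisFun` — `‖A‖ ≤ ∑_ι ‖A(e_{ι(1)}, …, e_{ι(m)})‖` for a continuous
  `m`-linear map on `(EuclideanSpace ℝ (Fin 3))` (expansion in the standard basis);
* `norm_iteratedFDeriv_apply_sub_le` — `x ↦ DᵐR(x)[W]` is Lipschitz with constant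
  `‖Dᵐ⁺¹R‖_∞ ∏‖Wₖ‖`.

## References

* H. Jia, V. Šverák, Invent. Math. 196 (2014) = arXiv:1204.0529, §4. Bib key `JiaSverak2014`.
-/

noncomputable section

open MeasureTheory Set Function Filter Metric
open _root_.Topology
open scoped RealInnerProductSpace

namespace Literature.Analysis.FluidPDE

namespace IteratedIBP

variable {E : Type*} [NormedAddCommGroup E] [NormedSpace ℝ E]

/-- Evaluating the `m`-th derivative of `y ↦ Dg(y) w` at `V` gives the `(m+1)`-th derivative of
`g` at `snoc`-type arguments: `Dᵐ(∂_w g)(x)[V] = Dᵐ⁺¹g(x)[W]` whenever `init W = V` and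
`W(last) = w`. [folklore] -/
theorem iteratedFDeriv_fderiv_apply_eq {F : Type*} [NormedAddCommGroup F] [NormedSpace ℝ F]
    {m : ℕ} {g : E → F} (hg : ContDiff ℝ (m + 1) g) (x : E) (W : Fin (m + 1) → E) :
    iteratedFDeriv ℝ m (fun y => fderiv ℝ g y (W (Fin.last m))) x (Fin.init W) =
      iteratedFDeriv ℝ (m + 1) g x W := by
  rw [iteratedFDeriv_succ_apply_right]
  have hfd : ContDiff ℝ m (fderiv ℝ g) := hg.fderiv_right (by norm_cast)
  set L : (E →L[ℝ] F) →L[ℝ] F := ContinuousLinearMap.apply ℝ F (W (Fin.last m)) with hL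
  have e : (fun y => fderiv ℝ g y (W (Fin.last m))) = L ∘ fun y => fderiv ℝ g y := by
    funext y; simp only [hL, Function.comp_apply, ContinuousLinearMap.apply_apply]
  rw [e, L.iteratedFDeriv_comp_left hfd.contDiffAt (by exact_mod_cast le_rfl)]
  simp only [hL, ContinuousLinearMap.compContinuousMultilinearMap_coe, Function.comp_apply,
    ContinuousLinearMap.apply_apply]

omit [NormedAddCommGroup E] [NormedSpace ℝ E] in
/-- `init (W ∘ rev) = (tail W) ∘ rev` and `(W ∘ rev)(last) = W 0`. [folklore] -/
theorem init_comp_rev {m : ℕ} (W : Fin (m + 1) → E) :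
    Fin.init (fun i => W (Fin.rev i)) = fun i => Fin.tail W (Fin.rev i) := by
  funext i
  simp only [Fin.init, Fin.tail, Fin.rev_castSucc]

/-- **Iterated directional integration by parts.** For `g ∈ Cᵐ((EuclideanSpace ℝ (Fin 3)))` and a smooth compactly
supported `φ`, `∫ g(x) Dᵐφ(x)[W] dx = (-1)ᵐ ∫ Dᵐg(x)[W ∘ rev] φ(x) dx`. [folklore] -/
theorem integral_mul_iteratedFDeriv_apply_eq (m : ℕ) {g : (EuclideanSpace ℝ (Fin 3)) → ℝ} (hg : ContDiff ℝ m g)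
    {φ : (EuclideanSpace ℝ (Fin 3)) → ℝ} (hφ : ContDiff ℝ (⊤ : ℕ∞) φ) (hφc : HasCompactSupport φ) (W : Fin m → (EuclideanSpace ℝ (Fin 3))) :
    ∫ x, g x * iteratedFDeriv ℝ m φ x W =
      (-1 : ℝ) ^ m * ∫ x, iteratedFDeriv ℝ m g x (fun i => W (Fin.rev i)) * φ x := by
  induction m generalizing g φ with
  | zero =>
    simp only [iteratedFDeriv_zero_apply, pow_zero, one_mul]
  | succ m ih =>
    -- peel the first direction off `φ`
    have hφ' : ContDiff ℝ (⊤ : ℕ∞) (iteratedFDeriv ℝ m φ) := hφ.iteratedFDeriv_right (by exact_mod_cast le_top)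
    have hdiff : ∀ x, DifferentiableAt ℝ (iteratedFDeriv ℝ m φ) x := fun x =>
      hφ.contDiffAt.differentiableAt_iteratedFDeriv (by exact_mod_cast ENat.coe_lt_top m)
    set ξ : (EuclideanSpace ℝ (Fin 3)) → ℝ := fun y => iteratedFDeriv ℝ m φ y (Fin.tail W) with hξ
    have hξs : ContDiff ℝ (⊤ : ℕ∞) ξ := by
      have e : ξ = (ContinuousMultilinearMap.apply ℝ (fun _ : Fin m => (EuclideanSpace ℝ (Fin 3))) ℝ (Fin.tail W)) ∘ iteratedFDeriv ℝ m φ := by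
        funext y; simp only [hξ, Function.comp_apply, ContinuousMultilinearMap.apply_apply]
      rw [e]
      exact (ContinuousMultilinearMap.apply ℝ (fun _ : Fin m => (EuclideanSpace ℝ (Fin 3))) ℝ (Fin.tail W)).contDiff.comp hφ'
    have hξc : HasCompactSupport ξ :=
      (hφc.iteratedFDeriv (𝕜 := ℝ) m).comp_left (g := fun M : (EuclideanSpace ℝ (Fin 3)) [×m]→L[ℝ] ℝ => M (Fin.tail W)) (by simp)
    have e1 : ∀ x, iteratedFDeriv ℝ (m + 1) φ x W = fderiv ℝ ξ x (W 0) := fun x =>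
      (hdiff x).iteratedFDeriv_succ_apply_left'
    simp_rw [e1]
    -- one integration by parts
    have hg1 : ContDiff ℝ 1 g := hg.of_le (by exact_mod_cast Nat.succ_le_succ (Nat.zero_le m))
    rw [PoissonWeyl.integral_mul_fderiv_apply_eq_neg hg1 (hξs.of_le (by exact_mod_cast le_top)) hξc (W 0)]
    -- the induction hypothesis for `∂_{W 0} g` against `φ` with the directions `tail W`
    have hg' : ContDiff ℝ m (fun y => fderiv ℝ g y (W 0)) :=
      (hg.fderiv_right (by norm_cast)).clm_apply contDiff_const
    have ih' := ih hg' hφ hφc (Fin.tail W)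
    simp only [hξ]
    rw [ih']
    -- identify the derivative on `g`
    have e2 : ∀ x, iteratedFDeriv ℝ m (fun y => fderiv ℝ g y (W 0)) x (fun i => Fin.tail W (Fin.rev i)) =
        iteratedFDeriv ℝ (m + 1) g x (fun i => W (Fin.rev i)) := by
      intro x
      have h := iteratedFDeriv_fderiv_apply_eq hg x (fun i => W (Fin.rev i))
      rw [init_comp_rev] at h
      simpa only [Fin.rev_last] using h
    simp_rw [e2]
    rw [pow_succ]
    ring

/-- **Norm of a multilinear map through the standard basis of `(EuclideanSpace ℝ (Fin 3))`.**
`‖A‖ ≤ ∑_{ι : Fin m → Fin 3} ‖A(e_{ι 0}, …, e_{ι (m-1)})‖`. [folklore] -/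
theorem norm_le_sum_norm_apply_basisFun {G : Type*} [NormedAddCommGroup G] [NormedSpace ℝ G] {m : ℕ}
    (A : ContinuousMultilinearMap ℝ (fun _ : Fin m => (EuclideanSpace ℝ (Fin 3))) G) :
    ‖A‖ ≤ ∑ ι : Fin m → Fin 3, ‖A (fun k => EuclideanSpace.basisFun (Fin 3) ℝ (ι k))‖ := by
  classical
  set b : OrthonormalBasis (Fin 3) ℝ (EuclideanSpace ℝ (Fin 3)) := EuclideanSpace.basisFun (Fin 3) ℝ with hb
  have hb1 : ∀ i, ‖b i‖ = 1 := fun i => b.orthonormal.1 i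
  refine ContinuousMultilinearMap.opNorm_le_bound (Finset.sum_nonneg fun _ _ => norm_nonneg _) fun v => ?_
  have hv : v = fun k => ∑ i, ⟪b i, v k⟫ • b i := by
    funext k; exact (b.sum_repr' (v k)).symm
  have hexp : A v = ∑ ι : Fin m → Fin 3, (∏ k, ⟪b (ι k), v k⟫) • A (fun k => b (ι k)) := by
    conv_lhs => rw [hv]
    rw [ContinuousMultilinearMap.map_sum]
    refine Finset.sum_congr rfl fun ι _ => ?_
    exact A.map_smul_univ (fun k => ⟪b (ι k), v k⟫) (fun k => b (ι k))
  rw [hexp]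
  calc ‖∑ ι : Fin m → Fin 3, (∏ k, ⟪b (ι k), v k⟫) • A (fun k => b (ι k))‖
      ≤ ∑ ι : Fin m → Fin 3, ‖(∏ k, ⟪b (ι k), v k⟫) • A (fun k => b (ι k))‖ := norm_sum_le _ _
    _ ≤ ∑ ι : Fin m → Fin 3, ‖A (fun k => b (ι k))‖ * ∏ k, ‖v k‖ := by
        refine Finset.sum_le_sum fun ι _ => ?_
        rw [norm_smul, mul_comm, Real.norm_eq_abs, Finset.abs_prod]
        refine mul_le_mul_of_nonneg_left (Finset.prod_le_prod (fun k _ => abs_nonneg _) fun k _ => ?_) (norm_nonneg _)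
        calc |⟪b (ι k), v k⟫| ≤ ‖b (ι k)‖ * ‖v k‖ := abs_real_inner_le_norm _ _
          _ = ‖v k‖ := by rw [hb1, one_mul]
    _ = (∑ ι : Fin m → Fin 3, ‖A (fun k => b (ι k))‖) * ∏ k, ‖v k‖ := by rw [Finset.sum_mul]

/-- **`x ↦ DᵐR(x)[W]` is Lipschitz** with constant `𝒞 ∏‖Wₖ‖` when `‖Dᵐ⁺¹R‖ ≤ 𝒞`. [folklore] -/
theorem norm_iteratedFDeriv_apply_sub_le {F : Type*} [NormedAddCommGroup F] [NormedSpace ℝ F]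
    {m : ℕ} {R : E → F} (hR : ContDiff ℝ (m + 1) R) {𝒞 : ℝ}
    (h𝒞 : ∀ x, ‖iteratedFDeriv ℝ (m + 1) R x‖ ≤ 𝒞) (W : Fin m → E) (x y : E) :
    ‖iteratedFDeriv ℝ m R x W - iteratedFDeriv ℝ m R y W‖ ≤ 𝒞 * (∏ k, ‖W k‖) * ‖x - y‖ := by
  have hdiff : ∀ z, DifferentiableAt ℝ (iteratedFDeriv ℝ m R) z := fun z =>
    hR.contDiffAt.differentiableAt_iteratedFDeriv (by exact_mod_cast Nat.lt_succ_self m)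
  have hbound : ∀ z ∈ (univ : Set E), ‖fderiv ℝ (iteratedFDeriv ℝ m R) z‖ ≤ 𝒞 := fun z _ => by
    rw [norm_fderiv_iteratedFDeriv]; exact h𝒞 z
  have hmv : ‖iteratedFDeriv ℝ m R x - iteratedFDeriv ℝ m R y‖ ≤ 𝒞 * ‖x - y‖ :=
    Convex.norm_image_sub_le_of_norm_fderiv_le (fun z _ => hdiff z) hbound convex_univ (mem_univ y) (mem_univ x)
  calc ‖iteratedFDeriv ℝ m R x W - iteratedFDeriv ℝ m R y W‖
      = ‖(iteratedFDeriv ℝ m R x - iteratedFDeriv ℝ m R y) W‖ := rfl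
    _ ≤ ‖iteratedFDeriv ℝ m R x - iteratedFDeriv ℝ m R y‖ * ∏ k, ‖W k‖ := ContinuousMultilinearMap.le_opNorm _ _
    _ ≤ 𝒞 * ‖x - y‖ * ∏ k, ‖W k‖ := mul_le_mul_of_nonneg_right hmv (Finset.prod_nonneg fun _ _ => norm_nonneg _)
    _ = 𝒞 * (∏ k, ‖W k‖) * ‖x - y‖ := by ring

/-- The product of the norms of a tuple of standard basis vectors is `1`. [folklore] -/
theorem prod_norm_basisFun {m : ℕ} (ι : Fin m → Fin 3) :
    ∏ k, ‖(fun k => EuclideanSpace.basisFun (Fin 3) ℝ (ι k)) k‖ = 1 := by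
  refine Finset.prod_eq_one fun k _ => ?_
  exact (EuclideanSpace.basisFun (Fin 3) ℝ).orthonormal.1 (ι k)

/-- Components of iterated derivatives: `Dᵐ⟪R, e⟫(x)[V] = ⟪DᵐR(x)[V], e⟫`. [folklore] -/
theorem iteratedFDeriv_inner_apply {m : ℕ} {R : (EuclideanSpace ℝ (Fin 3)) → (EuclideanSpace ℝ (Fin 3))} (hR : ContDiff ℝ m R) (e : (EuclideanSpace ℝ (Fin 3))) (x : (EuclideanSpace ℝ (Fin 3)))
    (V : Fin m → (EuclideanSpace ℝ (Fin 3))) :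
    iteratedFDeriv ℝ m (fun y => ⟪R y, e⟫) x V = ⟪iteratedFDeriv ℝ m R x V, e⟫ := by
  set L : (EuclideanSpace ℝ (Fin 3)) →L[ℝ] ℝ := innerSL ℝ e with hL
  have he : (fun y => ⟪R y, e⟫) = L ∘ R := by
    funext y; simp only [hL, Function.comp_apply, innerSL_apply_apply, real_inner_comm]
  rw [he, L.iteratedFDeriv_comp_left hR.contDiffAt (by exact_mod_cast le_rfl)]
  simp only [hL, ContinuousLinearMap.compContinuousMultilinearMap_coe, Function.comp_apply, innerSL_apply_apply,
    real_inner_comm]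

end IteratedIBP

end Literature.Analysis.FluidPDE
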